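import Literature.NumberTheory.EllipticCurves.ShintaniKernelPoisson
import Literature.NumberTheory.EllipticCurves.Shintani32GenusSymbols
import HarnessLib

/-!
# The twisted Shintani theta kernels on the level-`32` lattice `L♮₃₂ = {[32a, b, c]}`

[[cite: Shintani1975, §2 (2.1), (2.12), Thm. 2]] — the `N = 32` member of Shintani's family of
kernels (the tree's `ShintaniKernelLevel64`/`ShintaniKernelPoisson` is `N = 64`): on the lattice
`L♮₃₂ = {ι♮₃₂(k) = [32k₀, k₁, k₂]}` with the weight `c_D = ω_D` of `Shintani32GenusSymbols` supported
on the sublattice `L₃₂ = {64 ∣ k₁} = {[32v₀, 64v₁, v₂]}` and the scale `t = 1/(128D)`, the kernel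
`K₃₂,D(w, z) = (Im z)^{1/2} ∑_k c_D(k) f_{w, z/(128D)}(ι♮₃₂ k)` is the theta kernel that lifts the
LEVEL-`32` newform `φ` into Tunnell's space `S_{3/2}(128, 1)` (route to
`Literature.NumberTheory.EllipticCurves.Tunnell1983_a_sq_propto_L_one`).  This file is the
lattice/bookkeeping layer, parallel to `ShintaniKernelLevel64` (all lattice-free analysis —
`shintaniFn`, its `SL₂`-equivariance, decay, Poisson over diagonal lattices — is imported from
the tree):

* `latSharp32`, `latFun32`, `embed32`, `actSharp32` (+ composition, bijection), `disc ι♮₃₂(k) = k₁² - 128k₀k₂`;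
* `genKernel32 c t` — the generalized kernel on `L♮₃₂`; absolute convergence (`summable_term32`),
  **weight `-2` in `w` under `Γ₀(32)`** for `Γ₀(32)`-invariant weights (`genKernel32_sl_smul`),
  real translations in `z` (`genKernel32_vadd`, `…_of_int`), oddness `(1+s)𝒦 = 0`;
* `cD32`, **`kerD32 D = genKernel32 (cD32 D) (1/(128D))`** — bounded `Γ₀(32)`-invariant weight
  (`invWeight32_cD32`), the `w`-law `kerD32_sl_smul`, `L₃₂`-coordinates (`kerD32_eq_tsum`), and the
  `T`-law `kerD32_T_smul` (the exponents `disc/(128D) = n₃₂(v)/D` are integers on the support).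

No named facts; definitions `latSharp32`, `latFun32`, `embed32`, `actSharp32`, `actSharp32Equiv`,
`genKernel32`, `InvWeight32`, `cD32`, `kerD32`.
-/

noncomputable section

open Complex Real
open scoped MatrixGroups

namespace Literature.NumberTheory.EllipticCurves.Shintani

open UpperHalfPlane hiding I

/-! ### The lattices `L♮₃₂ = {[32a, b, c]} ⊇ L₃₂ = {[32a, 64b, c]}` in coordinates -/

/-- `ι♮₃₂(k) = [32 k₀, k₁, k₂]`. [folklore] -/
def latSharp32 (k : Fin 3 → ℤ) : V := !₂[32 * (k 0 : ℝ), (k 1 : ℝ), (k 2 : ℝ)]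

/-- `ι₃₂(v) = [32 v₀, 64 v₁, v₂]`. [folklore] -/
def latFun32 (v : Fin 3 → ℤ) : V := !₂[32 * (v 0 : ℝ), 64 * (v 1 : ℝ), (v 2 : ℝ)]

/-- The inclusion `L₃₂ ⊆ L♮₃₂` in coordinates: `v ↦ (v₀, 64v₁, v₂)`. [folklore] -/
def embed32 (v : Fin 3 → ℤ) : Fin 3 → ℤ := ![v 0, 64 * v 1, v 2]

/-- `latSharp32_zero` (coordinate). [folklore] -/
@[simp] theorem latSharp32_zero (k : Fin 3 → ℤ) : latSharp32 k 0 = 32 * (k 0 : ℝ) := by simp [latSharp32]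
/-- `latSharp32_one` (coordinate). [folklore] -/
@[simp] theorem latSharp32_one (k : Fin 3 → ℤ) : latSharp32 k 1 = (k 1 : ℝ) := by simp [latSharp32]
/-- `latSharp32_two` (coordinate). [folklore] -/
@[simp] theorem latSharp32_two (k : Fin 3 → ℤ) : latSharp32 k 2 = (k 2 : ℝ) := by simp [latSharp32]
/-- `latFun32_zero` (coordinate). [folklore] -/
@[simp] theorem latFun32_zero (v : Fin 3 → ℤ) : latFun32 v 0 = 32 * (v 0 : ℝ) := by simp [latFun32]
/-- `latFun32_one` (coordinate). [folklore] -/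
@[simp] theorem latFun32_one (v : Fin 3 → ℤ) : latFun32 v 1 = 64 * (v 1 : ℝ) := by simp [latFun32]
/-- `latFun32_two` (coordinate). [folklore] -/
@[simp] theorem latFun32_two (v : Fin 3 → ℤ) : latFun32 v 2 = (v 2 : ℝ) := by simp [latFun32]
/-- `embed32_zero` (coordinate). [folklore] -/
@[simp] theorem embed32_zero (v : Fin 3 → ℤ) : embed32 v 0 = v 0 := rfl
/-- `embed32_one` (coordinate). [folklore] -/
@[simp] theorem embed32_one (v : Fin 3 → ℤ) : embed32 v 1 = 64 * v 1 := rfl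
/-- `embed32_two` (coordinate). [folklore] -/
@[simp] theorem embed32_two (v : Fin 3 → ℤ) : embed32 v 2 = v 2 := rfl

/-- `latSharp32_embed32` (auxiliary). [folklore] -/
theorem latSharp32_embed32 (v : Fin 3 → ℤ) : latSharp32 (embed32 v) = latFun32 v := by
  ext i; fin_cases i <;> simp [latSharp32, latFun32, embed32]

/-- `embed32_injective` (auxiliary). [folklore] -/
theorem embed32_injective : Function.Injective embed32 := by
  intro v u h
  funext i
  fin_cases i
  · simpa using congrFun h 0
  · have := congrFun h 1; simp at this; exact this
  · simpa using congrFun h 2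

/-- `latSharp32_add` (auxiliary). [folklore] -/
theorem latSharp32_add (k l : Fin 3 → ℤ) : latSharp32 (k + l) = latSharp32 k + latSharp32 l := by
  ext i; fin_cases i <;> simp [latSharp32, mul_add]

/-- `latSharp32_neg` (auxiliary). [folklore] -/
theorem latSharp32_neg (k : Fin 3 → ℤ) : latSharp32 (-k) = -latSharp32 k := by
  ext i; fin_cases i <;> simp [latSharp32]

/-- `latSharp32_injective` (auxiliary). [folklore] -/
theorem latSharp32_injective : Function.Injective latSharp32 := by
  intro k l h
  funext i
  fin_cases i
  · have := congrArg (· 0) h; simp [latSharp32] at this; exact_mod_cast this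
  · have := congrArg (· 1) h; simp [latSharp32] at this; exact_mod_cast this
  · have := congrArg (· 2) h; simp [latSharp32] at this; exact_mod_cast this

/-- `disc ι♮₃₂(k) = k₁² - 128 k₀k₂`. [folklore] -/
theorem disc_latSharp32 (k : Fin 3 → ℤ) : disc (latSharp32 k) = ((k 1 ^ 2 - 128 * k 0 * k 2 : ℤ) : ℝ) := by
  simp only [disc, latSharp32_zero, latSharp32_one, latSharp32_two]; push_cast; ring

/-- `disc ι₃₂(v) = 128 n₃₂(v)`. [folklore] -/
theorem disc_latFun32 (v : Fin 3 → ℤ) : disc (latFun32 v) = 128 * (nQ32 v : ℝ) := by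
  simp only [disc, latFun32_zero, latFun32_one, latFun32_two, nQ32]; push_cast; ring

/-- `‖k‖_∞ ≤ ‖ι♮₃₂ k‖`. [folklore] -/
theorem abs_le_norm_latSharp32 (k : Fin 3 → ℤ) (i : Fin 3) : |(k i : ℝ)| ≤ ‖latSharp32 k‖ := by
  refine le_trans ?_ (abs_apply_le_norm (latSharp32 k) i)
  fin_cases i
  · show |((k 0 : ℤ) : ℝ)| ≤ |latSharp32 k 0|
    rw [latSharp32_zero, abs_mul, abs_of_pos (by norm_num : (0 : ℝ) < 32)]
    nlinarith [abs_nonneg ((k 0 : ℤ) : ℝ)]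
  · show |((k 1 : ℤ) : ℝ)| ≤ |latSharp32 k 1|
    rw [latSharp32_one]
  · show |((k 2 : ℤ) : ℝ)| ≤ |latSharp32 k 2|
    rw [latSharp32_two]

/-! ### The action of `Γ₀(32)` on `L♮₃₂` in coordinates -/

/-- For `g = (a b; 32c' d)`: coordinates of `ι♮₃₂(k) ∘ g`. [folklore] -/
def actSharp32 (a b c' d : ℤ) (k : Fin 3 → ℤ) : Fin 3 → ℤ :=
  ![k 0 * a ^ 2 + k 1 * a * c' + 32 * k 2 * c' ^ 2,
    64 * k 0 * a * b + k 1 * (a * d + 32 * b * c') + 64 * k 2 * c' * d,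
    32 * k 0 * b ^ 2 + k 1 * b * d + k 2 * d ^ 2]

/-- `ι♮₃₂(actSharp32 g k) = ι♮₃₂(k) ∘ g`. [folklore] -/
theorem latSharp32_actSharp32 (a b c' d : ℤ) (k : Fin 3 → ℤ) :
    latSharp32 (actSharp32 a b c' d k) = actV a b (32 * c') d (latSharp32 k) := by
  ext i
  fin_cases i <;> simp [latSharp32, actV, actSharp32] <;> ring

/-- Composition of the coordinate actions. [folklore] -/
theorem actSharp32_actSharp32 (a b c' d a₁ b₁ c₁' d₁ : ℤ) (k : Fin 3 → ℤ) :
    actSharp32 a b c' d (actSharp32 a₁ b₁ c₁' d₁ k) =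
      actSharp32 (a₁ * a + 32 * b₁ * c') (a₁ * b + b₁ * d) (c₁' * a + d₁ * c') (32 * c₁' * b + d₁ * d) k := by
  apply latSharp32_injective
  rw [latSharp32_actSharp32, latSharp32_actSharp32, latSharp32_actSharp32, actV_actV]
  congr 1
  all_goals (push_cast; ring)

/-- The identity acts trivially. [folklore] -/
theorem actSharp32_one (k : Fin 3 → ℤ) : actSharp32 1 0 0 1 k = k := by
  apply latSharp32_injective
  rw [latSharp32_actSharp32]
  push_cast
  rw [mul_zero]
  exact actV_id _

/-- `k ↦ actSharp32 g k` is a bijection of `ℤ³` for `g = (a b; 32c' d)` of determinant `1`. [folklore] -/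
def actSharp32Equiv (a b c' d : ℤ) (hdet : a * d - 32 * b * c' = 1) : (Fin 3 → ℤ) ≃ (Fin 3 → ℤ) where
  toFun := actSharp32 a b c' d
  invFun := actSharp32 d (-b) (-c') a
  left_inv k := by
    rw [actSharp32_actSharp32]
    have e1 : a * d + 32 * b * -c' = 1 := by linear_combination hdet
    have e2 : a * -b + b * a = 0 := by ring
    have e3 : c' * d + d * -c' = 0 := by ring
    have e4 : 32 * c' * -b + d * a = 1 := by linear_combination hdet
    rw [e1, e2, e3, e4, actSharp32_one]
  right_inv k := by
    rw [actSharp32_actSharp32]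
    have e1 : d * a + 32 * -b * c' = 1 := by linear_combination hdet
    have e2 : d * b + -b * d = 0 := by ring
    have e3 : -c' * a + a * c' = 0 := by ring
    have e4 : 32 * -c' * b + a * d = 1 := by linear_combination hdet
    rw [e1, e2, e3, e4, actSharp32_one]

/-- `actSharp32Equiv_apply` (auxiliary). [folklore] -/
@[simp] theorem actSharp32Equiv_apply (a b c' d : ℤ) (hdet : a * d - 32 * b * c' = 1) (k : Fin 3 → ℤ) :
    actSharp32Equiv a b c' d hdet k = actSharp32 a b c' d k := rfl

/-- The action preserves `L₃₂`: on embedded coordinates it is `actInt32`. [folklore] -/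
theorem actSharp32_embed32 (a b c' d : ℤ) (v : Fin 3 → ℤ) :
    actSharp32 a b c' d (embed32 v) = embed32 (actInt32 a b c' d v) := by
  funext i
  fin_cases i <;> simp [actSharp32, embed32, actInt32]
  ring

/-- `64 ∣ (actSharp32 g k)₁ ↔ 64 ∣ k₁` (for `ad - 32bc' = 1`). [folklore] -/
theorem dvd_actSharp32_one_iff {a b c' d : ℤ} (hdet : a * d - 32 * b * c' = 1) (k : Fin 3 → ℤ) :
    (64 : ℤ) ∣ actSharp32 a b c' d k 1 ↔ (64 : ℤ) ∣ k 1 := by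
  have e : actSharp32 a b c' d k 1 = k 1 + 64 * (k 0 * a * b + k 1 * b * c' + k 2 * c' * d) := by
    simp only [actSharp32, Matrix.cons_val_one, Matrix.cons_val_zero]
    linear_combination k 1 * hdet
  rw [e]
  exact dvd_add_left (dvd_mul_right 64 _)

/-! ### Generalized theta kernels on `L♮₃₂` -/

/-- **Generalized Shintani theta kernel on `L♮₃₂`** with weight `c` and scale `t > 0`:
`𝒦₃₂[c, t](w, z) = (Im z)^{1/2} ∑_{k ∈ ℤ³} c(k) f_{w, t z}(ι♮₃₂(k))`. [cite: Shintani1975, §2 (2.1)] -/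
def genKernel32 (c : (Fin 3 → ℤ) → ℂ) (t : ℝ) (ht : 0 < t) (w z : ℍ) : ℂ :=
  (Real.sqrt z.im : ℂ) * ∑' k : Fin 3 → ℤ, c k * shintaniFn w (mulPos t ht z) (latSharp32 k)

/-- Decay of the summands: `‖c(k) f_{w,Z}(ι♮₃₂ k)‖ ≤ C' (1 + ‖k‖_∞)⁻⁴`. [folklore] -/
theorem norm_term_le32 {c : (Fin 3 → ℤ) → ℂ} (hc : BddWeight c) (w Z : ℍ) :
    ∃ C' : ℝ, ∀ k : Fin 3 → ℤ,
      ‖c k * shintaniFn w Z (latSharp32 k)‖ ≤ C' * (1 + ‖fun i ↦ (k i : ℝ)‖) ^ (-(4 : ℝ)) := by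
  obtain ⟨C, hC⟩ := hc
  obtain ⟨C₁, hC₁⟩ := exists_norm_shintaniFn_le w Z
  have hC0 : 0 ≤ C := le_trans (norm_nonneg _) (hC 0)
  have hC₁0 : 0 ≤ C₁ := by
    have := hC₁ 0
    have h1 : (1 + ‖(0 : V)‖) ^ (-(4 : ℝ)) = 1 := by simp
    rw [h1, mul_one] at this
    exact le_trans (norm_nonneg _) this
  refine ⟨C * C₁, fun k ↦ ?_⟩
  rw [norm_mul]
  have hk : ‖fun i ↦ (k i : ℝ)‖ ≤ ‖latSharp32 k‖ := by
    refine (pi_norm_le_iff_of_nonneg (norm_nonneg _)).mpr fun i ↦ ?_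
    rw [Real.norm_eq_abs]
    exact abs_le_norm_latSharp32 k i
  have hdec : (1 + ‖latSharp32 k‖) ^ (-(4 : ℝ)) ≤ (1 + ‖fun i ↦ (k i : ℝ)‖) ^ (-(4 : ℝ)) := by
    apply Real.rpow_le_rpow_of_nonpos (by positivity) (by linarith) (by norm_num)
  calc ‖c k‖ * ‖shintaniFn w Z (latSharp32 k)‖
      ≤ C * (C₁ * (1 + ‖latSharp32 k‖) ^ (-(4 : ℝ))) :=
        mul_le_mul (hC k) (hC₁ _) (norm_nonneg _) hC0
    _ ≤ C * (C₁ * (1 + ‖fun i ↦ (k i : ℝ)‖) ^ (-(4 : ℝ))) := by gcongr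
    _ = C * C₁ * (1 + ‖fun i ↦ (k i : ℝ)‖) ^ (-(4 : ℝ)) := by ring

open Literature.NumberTheory.LFunctions.Fourier (summable_one_add_norm_rpow_neg) in
/-- **Absolute convergence** of the generalized kernels on `L♮₃₂`. [folklore] -/
theorem summable_term32 {c : (Fin 3 → ℤ) → ℂ} (hc : BddWeight c) (w Z : ℍ) :
    Summable fun k : Fin 3 → ℤ ↦ c k * shintaniFn w Z (latSharp32 k) := by
  obtain ⟨C', hC'⟩ := norm_term_le32 hc w Z
  refine Summable.of_norm_bounded ((summable_one_add_norm_rpow_neg (ι := Fin 3) (b := 4)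
    (by norm_num)).mul_left C') hC'

/-! ### The `w`-law: weight `-2` under `Γ₀(32)` for invariant weights -/

/-- A weight is `Γ₀(32)`-invariant if it is constant along the coordinate action of every
`g = (a b; 32c' d)` of determinant `1`. [folklore] -/
def InvWeight32 (c : (Fin 3 → ℤ) → ℂ) : Prop :=
  ∀ a b c' d : ℤ, a * d - 32 * b * c' = 1 → ∀ k, c (actSharp32 a b c' d k) = c k

/-- **Weight `-2` in `w`**: `𝒦₃₂[c,t](γw, z) (c_γ w + d_γ)² = 𝒦₃₂[c,t](w, z)` for `γ ∈ Γ₀(32)` and a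
`Γ₀(32)`-invariant bounded weight `c`. [cite: Shintani1975, (2.12)] -/
theorem genKernel32_sl_smul {c : (Fin 3 → ℤ) → ℂ} (hinv : InvWeight32 c)
    (t : ℝ) (ht : 0 < t) (γ : SL(2, ℤ)) (hγ : (32 : ℤ) ∣ γ 1 0) (w z : ℍ) :
    genKernel32 c t ht (γ • w) z * (((γ 1 0 : ℤ) : ℂ) * w + ((γ 1 1 : ℤ) : ℂ)) ^ 2 =
      genKernel32 c t ht w z := by
  obtain ⟨c', hc'⟩ := hγ
  have hdet : (γ 0 0 : ℤ) * γ 1 1 - 32 * γ 0 1 * c' = 1 := by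
    have := Literature.NumberTheory.EllipticCurves.ModularForms.det_eq_one' γ
    rw [hc'] at this
    linear_combination this
  unfold genKernel32
  rw [mul_assoc, mul_comm (∑' k, _) _, ← mul_assoc, mul_assoc]
  congr 1
  rw [← tsum_mul_left]
  have hterm : ∀ k : Fin 3 → ℤ, (((γ 1 0 : ℤ) : ℂ) * w + ((γ 1 1 : ℤ) : ℂ)) ^ 2 *
      (c k * shintaniFn (γ • w) (mulPos t ht z) (latSharp32 k)) =
      c (actSharp32 (γ 0 0) (γ 0 1) c' (γ 1 1) k) *
        shintaniFn w (mulPos t ht z) (latSharp32 (actSharp32 (γ 0 0) (γ 0 1) c' (γ 1 1) k)) := by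
    intro k
    rw [hinv _ _ _ _ hdet k, latSharp32_actSharp32]
    have h := shintaniFn_sl_smul γ w (mulPos t ht z) (latSharp32 k)
    rw [hc'] at h ⊢
    have e32 : ((32 * c' : ℤ) : ℝ) = 32 * (c' : ℝ) := by push_cast; ring
    rw [e32] at h
    rw [h]; ring
  exact (tsum_congr hterm).trans
    ((actSharp32Equiv _ _ _ _ hdet).tsum_eq (fun k ↦ c k * shintaniFn w (mulPos t ht z) (latSharp32 k)))

/-! ### Real translations in `z` and oddness -/

/-- **`z ↦ z + u`**: `𝒦₃₂[c,t](w, u + z) = 𝒦₃₂[c_u,t](w, z)` with `c_u(k) = c(k) e(t u · disc ι♮₃₂(k))`.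
[folklore] -/
theorem genKernel32_vadd (c : (Fin 3 → ℤ) → ℂ) (t : ℝ) (ht : 0 < t) (u : ℝ) (w z : ℍ) :
    genKernel32 c t ht w (u +ᵥ z) =
      genKernel32 (fun k ↦ c k * cexp (2 * π * I * (t * u * disc (latSharp32 k)))) t ht w z := by
  unfold genKernel32
  have him : (u +ᵥ z).im = z.im := UpperHalfPlane.vadd_im u z
  rw [him]
  congr 1
  refine tsum_congr fun k ↦ ?_
  have hpt : mulPos t ht (u +ᵥ z) = (t * u) +ᵥ mulPos t ht z := by
    apply UpperHalfPlane.ext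
    simp only [coe_mulPos, UpperHalfPlane.coe_vadd]
    push_cast; ring
  rw [hpt, shintaniFn_vadd]
  push_cast
  ring

/-- **Integral periods**: if `t u disc ι♮₃₂(k) ∈ ℤ` on the support of `c`, then
`𝒦₃₂[c,t](w, u + z) = 𝒦₃₂[c,t](w, z)`. [folklore] -/
theorem genKernel32_vadd_of_int {c : (Fin 3 → ℤ) → ℂ} {t : ℝ} (ht : 0 < t) {u : ℝ}
    (h : ∀ k, c k ≠ 0 → ∃ n : ℤ, t * u * disc (latSharp32 k) = n) (w z : ℍ) :
    genKernel32 c t ht w (u +ᵥ z) = genKernel32 c t ht w z := by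
  rw [genKernel32_vadd]
  unfold genKernel32
  congr 1
  refine tsum_congr fun k ↦ ?_
  dsimp only
  by_cases hk : c k = 0
  · rw [hk]; simp
  · obtain ⟨n, hn⟩ := h k hk
    have hn' : (t : ℂ) * (u : ℂ) * (disc (latSharp32 k) : ℂ) = (n : ℂ) := by exact_mod_cast hn
    have : cexp (2 * π * I * ((t : ℂ) * (u : ℂ) * (disc (latSharp32 k) : ℂ))) = 1 := by
      rw [hn', show 2 * (π : ℂ) * I * (n : ℂ) = n * (2 * π * I) by ring]
      exact Complex.exp_int_mul_two_pi_mul_I n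
    rw [this, mul_one]

/-- **Oddness**: a weight with `c(-k) = s c(k)` gives `(1 + s) 𝒦₃₂[c,t] = 0`. [folklore] -/
theorem genKernel32_of_weight_neg {c : (Fin 3 → ℤ) → ℂ} (_hc : BddWeight c) {s : ℂ}
    (hs : ∀ k, c (-k) = s * c k) (t : ℝ) (ht : 0 < t) (w z : ℍ) :
    (1 + s) * genKernel32 c t ht w z = 0 := by
  unfold genKernel32
  set F : (Fin 3 → ℤ) → ℂ := fun k ↦ c k * shintaniFn w (mulPos t ht z) (latSharp32 k) with hF
  have h1 : ∀ k, F (-k) = -(s * F k) := fun k ↦ by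
    simp only [hF, hs k, latSharp32_neg, shintaniFn_neg]
    ring
  have hneg : ∑' k, F k = -(s * ∑' k, F k) := by
    have e := (Equiv.neg (Fin 3 → ℤ)).tsum_eq F
    simp only [Equiv.neg_apply] at e
    calc ∑' k, F k = ∑' k, F (-k) := e.symm
      _ = ∑' k, -(s * F k) := tsum_congr h1
      _ = -(s * ∑' k, F k) := by rw [tsum_neg, tsum_mul_left]
  have : (1 + s) * ∑' k, F k = 0 := by linear_combination hneg
  rw [mul_left_comm, this, mul_zero]

/-! ### The weight `c_D` on `L♮₃₂` and the kernel `K₃₂,D` -/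

/-- The weight of the `D`-th kernel on `L♮₃₂`-coordinates: `ω_D` (`genusWt32`) on the sublattice
`L₃₂ = {64 ∣ k₁}`, `0` elsewhere. [folklore] -/
def cD32 (D : ℕ) (k : Fin 3 → ℤ) : ℂ :=
  if (64 : ℤ) ∣ k 1 then (genusWt32 D ![k 0, k 1 / 64, k 2] : ℂ) else 0

/-- `cD32_embed32` (auxiliary). [folklore] -/
theorem cD32_embed32 (D : ℕ) (v : Fin 3 → ℤ) : cD32 D (embed32 v) = genusWt32 D v := by
  unfold cD32
  rw [if_pos (by simp : (64 : ℤ) ∣ embed32 v 1)]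
  congr 1
  congr 1
  funext i
  fin_cases i <;> simp

/-- `cD32_of_not_dvd` (auxiliary). [folklore] -/
theorem cD32_of_not_dvd {D : ℕ} {k : Fin 3 → ℤ} (h : ¬ (64 : ℤ) ∣ k 1) : cD32 D k = 0 := by
  simp [cD32, h]

/-- `bddWeight_cD32` (auxiliary). [folklore] -/
theorem bddWeight_cD32 (D : ℕ) : BddWeight (cD32 D) := by
  refine ⟨1, fun k ↦ ?_⟩
  unfold cD32
  split_ifs
  · rw [Complex.norm_intCast]
    exact_mod_cast abs_genusWt32_le D _
  · simp

/-- **`c_D` is `Γ₀(32)`-invariant** (`D` odd). [folklore] -/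
theorem invWeight32_cD32 {D : ℕ} (hD : Odd D) : InvWeight32 (cD32 D) := by
  intro a b c' d hdet k
  by_cases hk : (64 : ℤ) ∣ k 1
  · obtain ⟨k1, hk1⟩ := hk
    set v : Fin 3 → ℤ := ![k 0, k1, k 2] with hv
    have hkv : k = embed32 v := by
      funext i; fin_cases i <;> simp [hv, embed32, hk1]
    rw [hkv, actSharp32_embed32, cD32_embed32, cD32_embed32, genusWt32_actInt32 hD hdet]
  · rw [cD32_of_not_dvd hk, cD32_of_not_dvd ((dvd_actSharp32_one_iff hdet k).not.mpr hk)]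

/-- The parity of `c_D`: `c_D(-k) = -c_D(k)` (`D` odd square-free). [folklore] -/
theorem cD32_neg {D : ℕ} (hD : Squarefree D) (hDodd : Odd D) (k : Fin 3 → ℤ) :
    cD32 D (-k) = -cD32 D k := by
  unfold cD32
  have hiff : (64 : ℤ) ∣ (-k) 1 ↔ (64 : ℤ) ∣ k 1 := by simp
  by_cases hk : (64 : ℤ) ∣ k 1
  · rw [if_pos (hiff.mpr hk), if_pos hk]
    have hv : (![(-k) 0, (-k) 1 / 64, (-k) 2] : Fin 3 → ℤ) = -![k 0, k 1 / 64, k 2] := by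
      obtain ⟨k1, hk1⟩ := hk
      have e1 : -(64 * k1) / 64 = -k1 := by omega
      funext i
      fin_cases i <;> simp [hk1, e1]
    rw [hv, genusWt32_neg hD hDodd]
    push_cast
    ring
  · rw [if_neg (mt hiff.mp hk), if_neg hk, neg_zero]

/-- Scale of the `D`-th kernel: `t_D = 1/(128 D)`. [folklore] -/
theorem scale32_pos (D : ℕ) [NeZero D] : (0 : ℝ) < 1 / (128 * D) := by
  have : (0 : ℝ) < D := by exact_mod_cast Nat.pos_of_ne_zero (NeZero.ne D)
  positivity

/-- **The `D`-th twisted Shintani theta kernel on `L♮₃₂`**: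
`K₃₂,D(w, z) = (Im z)^{1/2} ∑_{k ∈ L♮₃₂} c_D(k) f_{w, z/(128D)}(ι♮₃₂ k)`. [cite: Shintani1975, §2 (2.1), Thm. 2] -/
def kerD32 (D : ℕ) [NeZero D] (w z : ℍ) : ℂ := genKernel32 (cD32 D) (1 / (128 * D)) (scale32_pos D) w z

/-- A series on `L♮₃₂` supported on `L₃₂` is a series on `L₃₂`. [folklore] -/
theorem tsum_cD32_mul (D : ℕ) (F : V → ℂ) :
    ∑' k : Fin 3 → ℤ, cD32 D k * F (latSharp32 k) = ∑' v : Fin 3 → ℤ, (genusWt32 D v : ℂ) * F (latFun32 v) := by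
  have hsupp : Function.support (fun k : Fin 3 → ℤ ↦ cD32 D k * F (latSharp32 k)) ⊆ Set.range embed32 := by
    intro k hk
    rw [Function.mem_support] at hk
    by_cases h : (64 : ℤ) ∣ k 1
    · obtain ⟨k1, hk1⟩ := h
      exact ⟨![k 0, k1, k 2], by funext i; fin_cases i <;> simp [embed32, hk1]⟩
    · exact absurd (by rw [cD32_of_not_dvd h, zero_mul]) hk
  rw [← tsum_subtype_eq_of_support_subset hsupp]
  rw [← (Equiv.ofInjective embed32 embed32_injective).tsum_eq]
  refine tsum_congr fun v ↦ ?_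
  simp only [Equiv.ofInjective_apply]
  rw [cD32_embed32, latSharp32_embed32]

/-- **`K₃₂,D` in `L₃₂`-coordinates**: `K₃₂,D(w,z) = (Im z)^{1/2} ∑_v ω_D(v) f_{w, z/(128D)}(ι₃₂ v)`. [folklore] -/
theorem kerD32_eq_tsum (D : ℕ) [NeZero D] (w z : ℍ) :
    kerD32 D w z = (Real.sqrt z.im : ℂ) * ∑' v : Fin 3 → ℤ, (genusWt32 D v : ℂ) *
      shintaniFn w (mulPos (1 / (128 * D)) (scale32_pos D) z) (latFun32 v) := by
  unfold kerD32 genKernel32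
  rw [tsum_cD32_mul D _]

/-- **Weight `-2` in `w` under `Γ₀(32)`**: `K₃₂,D(γw, z)(c_γ w + d_γ)² = K₃₂,D(w, z)` (`D` odd).
[cite: Shintani1975, (2.12)] -/
theorem kerD32_sl_smul {D : ℕ} [NeZero D] (hD : Odd D) (γ : SL(2, ℤ)) (hγ : (32 : ℤ) ∣ γ 1 0)
    (w z : ℍ) :
    kerD32 D (γ • w) z * (((γ 1 0 : ℤ) : ℂ) * w + ((γ 1 1 : ℤ) : ℂ)) ^ 2 = kerD32 D w z :=
  genKernel32_sl_smul (invWeight32_cD32 hD) _ _ γ hγ w z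

/-- **The `T`-law**: `K₃₂,D(w, z + 1) = K₃₂,D(w, z)` (`D` square-free): on the support of the weight the
exponents `disc ι♮₃₂(k)/(128D) = n₃₂(v)/D` are integers. [folklore] -/
theorem kerD32_T_smul {D : ℕ} [NeZero D] (hsq : Squarefree D) (w z : ℍ) :
    kerD32 D w (ModularGroup.T • z) = kerD32 D w z := by
  rw [UpperHalfPlane.modular_T_smul]
  unfold kerD32
  apply genKernel32_vadd_of_int
  intro k hk
  by_cases h64 : (64 : ℤ) ∣ k 1
  · obtain ⟨k1, hk1⟩ := h64
    have hke : k = embed32 ![k 0, k1, k 2] := by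
      funext i; fin_cases i <;> simp [embed32, hk1]
    rw [hke, cD32_embed32] at hk
    have hne : genusWt32 D ![k 0, k1, k 2] ≠ 0 := fun h0 ↦ by apply hk; rw [h0]; simp
    have hDn : (D : ℤ) ∣ nQ32 ![k 0, k1, k 2] := by
      by_contra h; exact hne (genusWt32_of_not_dvd hsq h)
    obtain ⟨m, hm⟩ := hDn
    refine ⟨m, ?_⟩
    rw [hke, latSharp32_embed32, disc_latFun32, hm]
    have hD0 : (D : ℝ) ≠ 0 := by exact_mod_cast NeZero.ne D
    push_cast
    field_simp
  · exact absurd (cD32_of_not_dvd h64) hk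

end Literature.NumberTheory.EllipticCurves.Shintani
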